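import Literature.Topology.FourManifolds.AffineAmbientIsotopy
import Literature.Topology.FourManifolds.StraightLineAmbientIsotopy
import HarnessLib

/-!
# Local linearisation: a local diffeomorphism composed with a small affine map is ambient isotopic to the identity

Topic `Literature/Topology/FourManifolds`; a brick of the decomposition of the Fox–Milnor
congruence `Literature.Topology.FourManifolds.Knot.IsConnectedSum.isConcordant` (the "tiny copy
of the second factor" placed inside a tube chart must be shown isotopic to the factor itself).
Everything here is proved, for a general finite-dimensional real normed space `E` where
possible:

* `affineDiffeo a M : E ≃ₘ E`, `y ↦ a + M y`; `AmbientIsotopy.conjDiffeo` — conjugation of an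
  ambient isotopy by a diffeomorphism (the tree's `AmbientIsotopy.conj` for spheres, verbatim for
  a general manifold); compact support is kept under affine conjugation and stagewise
  composition (`exists_conjDiffeo_affine_eq_self`, `exists_comp_eq_self`).
* **`exists_ambientIsotopy_linearise`** — a `C^∞` map `g` with invertible derivative `L` at `x₀`
  satisfies `g y = g x₀ + L (F 1 y - x₀)` near `x₀` for a compactly supported ambient isotopy
  `F` of `E`: the straight-line isotopy extension theorem of the tree
  (`exists_ambientIsotopy_of_straightLine_one`, Hirsch Ch. 8 §1 Thm. 1.4) applied to
  `P = x₀ + L⁻¹ (g - g x₀)`, which fixes `x₀` with derivative `id`.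
* **`exists_ambientIsotopy_comp_affine`** (`E = ℝ³`) — for `M` with `det (L M) > 0`, a compact
  `Z` and a centre `c`, and all small `λ > 0`, the map `z ↦ g (x₀ + λ M (z - c))` is on `Z` the
  time-one map of a compactly supported ambient isotopy of `ℝ³` (linearisation conjugated by the
  affine approximation, preceded by the affine isotopy `AffineIsotopy.exists_ambientIsotopy_affine`
  from the identity to `z ↦ g x₀ + λ L M (z - c)`).

Read through a chart of `𝕊³`, the last statement says that a knot shrunk into a small chart
ball and re-embedded by any orientation-compatible local diffeomorphism is ambient isotopic to
the original knot (sequel).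

## References

* M. W. Hirsch, *Differential Topology*, GTM 33 (1976), Ch. 8 §1, Thm. 1.4 (isotopy extension
  with compact support); §3, proof of Thm. 3.1 (isotopy of disc embeddings through their
  linearisations and a path in `GL⁺`). [HirschDT1976]

## Design notes

No named facts, no `sorry`; `𝔼 n` is local notation as in `Knots.lean`.
-/

open scoped Manifold ContDiff Topology
open Function Set Metric

noncomputable section

namespace Literature.Topology.FourManifolds

/-! ### Affine diffeomorphisms and conjugation of ambient isotopies -/

section Conj

variable {E : Type*} [NormedAddCommGroup E] [NormedSpace ℝ E]

/-- The **affine diffeomorphism** `y ↦ a + M y` of a normed space. [folklore] -/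
def affineDiffeo (a : E) (M : E ≃L[ℝ] E) : E ≃ₘ⟮𝓘(ℝ, E), 𝓘(ℝ, E)⟯ E where
  toFun y := a + M y
  invFun y := M.symm (y - a)
  left_inv y := by simp
  right_inv y := by simp
  contMDiff_toFun := (contDiff_const.add M.contDiff).contMDiff
  contMDiff_invFun := (M.symm.contDiff.comp (contDiff_id.sub contDiff_const)).contMDiff

/-- The affine diffeomorphism as a function. [folklore] -/
@[simp]
theorem affineDiffeo_apply (a : E) (M : E ≃L[ℝ] E) (y : E) : affineDiffeo a M y = a + M y := rfl

/-- The inverse of the affine diffeomorphism. [folklore] -/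
@[simp]
theorem affineDiffeo_symm_apply (a : E) (M : E ≃L[ℝ] E) (y : E) :
    (affineDiffeo a M).symm y = M.symm (y - a) := rfl

variable {H : Type*} [TopologicalSpace H] {J : ModelWithCorners ℝ E H}
  {N : Type*} [TopologicalSpace N] [ChartedSpace H N]

namespace AmbientIsotopy

/-- **Conjugate of an ambient isotopy by a diffeomorphism**: `(F.conjDiffeo Ψ) t = Ψ ∘ F t ∘ Ψ⁻¹`
(the tree's `AmbientIsotopy.conj` for spheres, for a general manifold). Hirsch (1976), Ch. 8 §1.
[folklore] -/
def conjDiffeo (F : AmbientIsotopy J N) (Ψ : N ≃ₘ⟮J, J⟯ N) : AmbientIsotopy J N where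
  toFun t := Ψ ∘ F.toFun t ∘ Ψ.symm
  contMDiff :=
    Ψ.contMDiff.comp (F.contMDiff.comp (contMDiff_fst.prodMk (Ψ.symm.contMDiff.comp contMDiff_snd)))
  bijective t := Ψ.bijective.comp ((F.bijective t).comp Ψ.symm.bijective)
  isLocalDiffeomorph t := ((Ψ.symm.trans (F.toDiffeomorph t)).trans Ψ).isLocalDiffeomorph
  map_zero := by
    funext x
    simp [F.map_zero]

/-- Stages of the conjugate isotopy. [folklore] -/
@[simp]
theorem conjDiffeo_toFun (F : AmbientIsotopy J N) (Ψ : N ≃ₘ⟮J, J⟯ N) (t : ℝ) :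
    (F.conjDiffeo Ψ).toFun t = Ψ ∘ F.toFun t ∘ Ψ.symm :=
  rfl

/-- **A compactly supported isotopy of a normed space stays compactly supported under affine
conjugation.** [folklore] -/
theorem exists_conjDiffeo_affine_eq_self (F : AmbientIsotopy 𝓘(ℝ, E) E) (a : E) (M : E ≃L[ℝ] E)
    {R : ℝ} (hF : ∀ t y, R ≤ ‖y‖ → F.toFun t y = y) :
    ∃ R' : ℝ, ∀ t y, R' ≤ ‖y‖ → (F.conjDiffeo (affineDiffeo a M)).toFun t y = y := by
  refine ⟨‖a‖ + ‖(M : E →L[ℝ] E)‖ * |R| + 1, fun t y hy ↦ ?_⟩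
  rw [conjDiffeo_toFun, comp_apply, comp_apply, affineDiffeo_symm_apply, affineDiffeo_apply]
  have hR : R ≤ ‖M.symm (y - a)‖ := by
    have h1 : ‖y - a‖ ≤ ‖(M : E →L[ℝ] E)‖ * ‖M.symm (y - a)‖ := by
      have := (M : E →L[ℝ] E).le_opNorm (M.symm (y - a))
      simpa using this
    have h2 : ‖y‖ - ‖a‖ ≤ ‖y - a‖ := norm_sub_norm_le y a
    by_contra hlt
    rw [not_le] at hlt
    have h3 : ‖(M : E →L[ℝ] E)‖ * ‖M.symm (y - a)‖ ≤ ‖(M : E →L[ℝ] E)‖ * |R| :=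
      mul_le_mul_of_nonneg_left (hlt.le.trans (le_abs_self R)) (norm_nonneg _)
    linarith
  rw [hF t _ hR]
  simp

/-- The stages of a stagewise composition are the identity off one ball if both factors are.
[folklore] -/
theorem exists_comp_eq_self (F G : AmbientIsotopy 𝓘(ℝ, E) E) {R S : ℝ}
    (hF : ∀ t y, R ≤ ‖y‖ → F.toFun t y = y) (hG : ∀ t y, S ≤ ‖y‖ → G.toFun t y = y) :
    ∃ R' : ℝ, ∀ t y, R' ≤ ‖y‖ → (F.comp G).toFun t y = y := by
  refine ⟨max R S, fun t y hy ↦ ?_⟩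
  rw [comp_toFun, comp_apply, hF t y ((le_max_left _ _).trans hy), hG t y ((le_max_right _ _).trans hy)]

end AmbientIsotopy

end Conj

/-! ### Linearisation at a point -/

section Linearise

variable {E : Type*} [NormedAddCommGroup E] [NormedSpace ℝ E] [FiniteDimensional ℝ E]

/-- **A local diffeomorphism is ambient isotopic to its affine approximation near a point.**
Let `g` be `C^∞` on an open `W ∋ x₀` with invertible derivative `L` at `x₀`. Then there is a
compactly supported ambient isotopy `F` of `E` with
`g y = g x₀ + L (F 1 y - x₀)` for all `y` near `x₀`: apply the straight-line isotopy extension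
theorem (`exists_ambientIsotopy_of_straightLine_one`, Hirsch (1976), Ch. 8 §1, Thm. 1.4) to
`P = x₀ + L⁻¹ (g - g x₀)`, which fixes `x₀` with derivative the identity there.
[cite: HirschDT1976, Ch. 8 §1, Thm. 1.4] -/
theorem exists_ambientIsotopy_linearise {W : Set E} (hW : IsOpen W) {g : E → E}
    (hg : ContDiffOn ℝ ∞ g W) {x₀ : E} (hx₀ : x₀ ∈ W) (L : E ≃L[ℝ] E)
    (hL : HasFDerivAt g (L : E →L[ℝ] E) x₀) :
    ∃ F : AmbientIsotopy 𝓘(ℝ, E) E, (∀ᶠ y in 𝓝 x₀, g y = g x₀ + L (F.toFun 1 y - x₀)) ∧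
      ∃ R : ℝ, ∀ t (y : E), R ≤ ‖y‖ → F.toFun t y = y := by
  set P : E → E := fun y ↦ x₀ + L.symm (g y - g x₀) with hP
  have hPs : ContDiffOn ℝ ∞ P W :=
    contDiffOn_const.add (L.symm.contDiff.comp_contDiffOn (hg.sub contDiffOn_const))
  have hPx : ∀ z ∈ ({x₀} : Set E), P z = z := by
    intro z hz
    rw [mem_singleton_iff.1 hz, hP]
    simp
  have hD : ∀ z ∈ ({x₀} : Set E), HasFDerivAt P (ContinuousLinearMap.id ℝ E) z := by
    intro z hz
    rw [mem_singleton_iff.1 hz]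
    have h1 : HasFDerivAt (fun y ↦ g y - g x₀) (L : E →L[ℝ] E) x₀ := hL.sub_const _
    have h2 : HasFDerivAt (fun y ↦ L.symm (g y - g x₀))
        ((L.symm : E →L[ℝ] E).comp (L : E →L[ℝ] E)) x₀ :=
      L.symm.hasFDerivAt.comp x₀ h1
    have h3 := h2.const_add x₀
    have he : (L.symm : E →L[ℝ] E).comp (L : E →L[ℝ] E) = ContinuousLinearMap.id ℝ E := by
      ext v; simp
    rw [he] at h3
    exact h3
  have hinj : ∀ z ∈ ({x₀} : Set E), ∀ t ∈ Icc (0 : ℝ) 1,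
      Injective (slDeriv t (ContinuousLinearMap.id ℝ E)) := by
    intro z _ t _
    have : slDeriv t (ContinuousLinearMap.id ℝ E) = ContinuousLinearMap.id ℝ E := by
      simp [slDeriv]
    rw [this]
    exact injective_id
  obtain ⟨F, hF1, R, hR⟩ := exists_ambientIsotopy_of_straightLine_one isCompact_singleton hW
    (singleton_subset_iff.2 hx₀) hPs hPx hD hinj
  refine ⟨F, ?_, R, hR⟩
  rw [nhdsSet_singleton] at hF1
  filter_upwards [hF1] with y hy
  rw [hy, hP]
  simp

end Linearise

/-! ### The composite of a local diffeomorphism of `ℝ³` with a small affine map -/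

section Composite

open AffineIsotopy

/-- Local notation: `𝔼 n` is the model Euclidean space `EuclideanSpace ℝ (Fin n)`. -/
local notation "𝔼 " n:arg => EuclideanSpace ℝ (Fin n)

/-- Scaling a linear automorphism of `ℝ³` by a nonzero real. [folklore] -/
def smulEquiv {c : ℝ} (hc : c ≠ 0) (A : 𝔼 3 ≃L[ℝ] 𝔼 3) : 𝔼 3 ≃L[ℝ] 𝔼 3 :=
  ContinuousLinearEquiv.equivOfInverse (c • (A : 𝔼 3 →L[ℝ] 𝔼 3)) (c⁻¹ • (A.symm : 𝔼 3 →L[ℝ] 𝔼 3))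
    (fun x ↦ by simp [smul_smul, hc])
    (fun x ↦ by simp [smul_smul, hc])

/-- The scaled automorphism as a function. [folklore] -/
@[simp]
theorem smulEquiv_apply {c : ℝ} (hc : c ≠ 0) (A : 𝔼 3 ≃L[ℝ] 𝔼 3) (x : 𝔼 3) :
    smulEquiv hc A x = c • A x := rfl

/-- The matrix of the scaled automorphism. [folklore] -/
theorem toMat_smulEquiv {c : ℝ} (hc : c ≠ 0) (A : 𝔼 3 ≃L[ℝ] 𝔼 3) :
    toMat (smulEquiv hc A : 𝔼 3 →L[ℝ] 𝔼 3) = c • toMat (A : 𝔼 3 →L[ℝ] 𝔼 3) := by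
  have : (smulEquiv hc A : 𝔼 3 →L[ℝ] 𝔼 3) = c • (A : 𝔼 3 →L[ℝ] 𝔼 3) := rfl
  rw [this, toMat, map_smul]

/-- **A local diffeomorphism of `ℝ³` composed with a small orientation-compatible affine map is
the end of a compactly supported ambient isotopy on any compact set.** Let `g` be `C^∞` on an
open `W ∋ x₀` with invertible derivative `L` at `x₀`, `M` a linear automorphism with
`det (L M) > 0`, `Z` compact and `c` a point. For all sufficiently small `λ > 0` the map
`z ↦ g (x₀ + λ M (z - c))` agrees on `Z` with the time-one map of a compactly supported ambient
isotopy of `ℝ³`: linearise `g` at `x₀` (`exists_ambientIsotopy_linearise`), conjugate by the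
affine approximation, and precede by the affine isotopy from the identity to
`z ↦ g x₀ + λ L M (z - c)` (`AffineIsotopy.exists_ambientIsotopy_affine`). Hirsch (1976), Ch. 8
§1 Thm. 1.4 and §3, proof of Thm. 3.1. [cite: HirschDT1976, Ch. 8 §3, Thm. 3.1 (proof)] -/
theorem exists_ambientIsotopy_comp_affine {W : Set (𝔼 3)} (hW : IsOpen W) {g : 𝔼 3 → 𝔼 3}
    (hg : ContDiffOn ℝ ∞ g W) {x₀ : 𝔼 3} (hx₀ : x₀ ∈ W) (L M : 𝔼 3 ≃L[ℝ] 𝔼 3)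
    (hL : HasFDerivAt g (L : 𝔼 3 →L[ℝ] 𝔼 3) x₀)
    (hdet : 0 < (toMat ((L : 𝔼 3 →L[ℝ] 𝔼 3).comp (M : 𝔼 3 →L[ℝ] 𝔼 3))).det)
    {Z : Set (𝔼 3)} (hZ : IsCompact Z) (c : 𝔼 3) :
    ∃ l₀ : ℝ, 0 < l₀ ∧ ∀ l ∈ Ioo (0 : ℝ) l₀,
      (∀ z ∈ Z, x₀ + l • M (z - c) ∈ W) ∧
      ∃ F : AmbientIsotopy 𝓘(ℝ, 𝔼 3) (𝔼 3),
        (∀ z ∈ Z, F.toFun 1 z = g (x₀ + l • M (z - c))) ∧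
        ∃ R : ℝ, ∀ t (y : 𝔼 3), R ≤ ‖y‖ → F.toFun t y = y := by
  -- linearise `g` at `x₀`
  obtain ⟨Fl, hFl, Rl, hRl⟩ := exists_ambientIsotopy_linearise hW hg hx₀ L hL
  obtain ⟨r, hr, hball⟩ : ∃ r > 0, ball x₀ r ⊆ {y | g y = g x₀ + L (Fl.toFun 1 y - x₀)} ∩ W :=
    Metric.mem_nhds_iff.1 (Filter.inter_mem hFl (hW.mem_nhds hx₀))
  -- a radius for `Z` around `c`
  obtain ⟨ρ, hρ⟩ : ∃ ρ : ℝ, ∀ z ∈ Z, ‖z - c‖ ≤ ρ := by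
    obtain ⟨ρ, hρ⟩ := (hZ.image (continuous_id.sub continuous_const)).isBounded.subset_closedBall 0
    exact ⟨ρ, fun z hz ↦ by simpa using hρ ⟨z, hz, rfl⟩⟩
  have hρ0 : 0 ≤ max ρ 0 := le_max_right _ _
  set m : ℝ := ‖(M : 𝔼 3 →L[ℝ] 𝔼 3)‖ * max ρ 0 + 1 with hm
  have hm0 : 0 < m := by positivity
  refine ⟨r / m, div_pos hr hm0, fun l hl ↦ ?_⟩
  -- the affine contraction maps `Z` into the ball of linearisation
  have hT : ∀ z ∈ Z, x₀ + l • M (z - c) ∈ ball x₀ r := by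
    intro z hz
    rw [mem_ball, dist_eq_norm, add_sub_cancel_left, norm_smul, Real.norm_eq_abs, abs_of_pos hl.1]
    have h1 : ‖M (z - c)‖ ≤ ‖(M : 𝔼 3 →L[ℝ] 𝔼 3)‖ * max ρ 0 :=
      ((M : 𝔼 3 →L[ℝ] 𝔼 3).le_opNorm _).trans
        (mul_le_mul_of_nonneg_left ((hρ z hz).trans (le_max_left _ _)) (norm_nonneg _))
    have h2 : l * ‖M (z - c)‖ ≤ l * (‖(M : 𝔼 3 →L[ℝ] 𝔼 3)‖ * max ρ 0) :=
      mul_le_mul_of_nonneg_left h1 hl.1.le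
    have h3 : l * m < r := (lt_div_iff₀ hm0).1 hl.2
    have h4 : l * (‖(M : 𝔼 3 →L[ℝ] 𝔼 3)‖ * max ρ 0) ≤ l * m := by
      refine mul_le_mul_of_nonneg_left ?_ hl.1.le
      rw [hm]; linarith
    linarith
  refine ⟨fun z hz ↦ (hball (hT z hz)).2, ?_⟩
  -- the affine isotopy from the identity to `z ↦ g x₀ + l L M (z - c)`
  set L₁ : 𝔼 3 ≃L[ℝ] 𝔼 3 := smulEquiv hl.1.ne' (M.trans L) with hL₁
  have hdet' : 0 < (toMat ((ContinuousLinearEquiv.refl ℝ (𝔼 3) : 𝔼 3 ≃L[ℝ] 𝔼 3) :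
      𝔼 3 →L[ℝ] 𝔼 3)).det * (toMat (L₁ : 𝔼 3 →L[ℝ] 𝔼 3)).det := by
    have e1 : toMat ((ContinuousLinearEquiv.refl ℝ (𝔼 3) : 𝔼 3 ≃L[ℝ] 𝔼 3) : 𝔼 3 →L[ℝ] 𝔼 3) = 1 :=
      toMat_id
    have e2 : toMat (L₁ : 𝔼 3 →L[ℝ] 𝔼 3) =
        l • toMat ((L : 𝔼 3 →L[ℝ] 𝔼 3).comp (M : 𝔼 3 →L[ℝ] 𝔼 3)) := by
      rw [hL₁, toMat_smulEquiv]
      rfl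
    rw [e1, e2, Matrix.det_one, one_mul, Matrix.det_smul, Fintype.card_fin]
    exact mul_pos (pow_pos hl.1 _) hdet
  obtain ⟨Fa, hFa, Ra, hRa⟩ := exists_ambientIsotopy_affine c (g x₀) c
    (ContinuousLinearEquiv.refl ℝ (𝔼 3)) L₁ hdet' (max ρ 0)
  -- the conjugated linearisation isotopy
  set a : 𝔼 3 := g x₀ - L x₀ with ha
  obtain ⟨Rc, hRc⟩ := Fl.exists_conjDiffeo_affine_eq_self a L hRl
  obtain ⟨R, hR⟩ := Fa.exists_comp_eq_self (Fl.conjDiffeo (affineDiffeo a L)) hRa hRc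
  refine ⟨Fa.comp (Fl.conjDiffeo (affineDiffeo a L)), fun z hz ↦ ?_, R, hR⟩
  have hzc : z ∈ closedBall c (max ρ 0) := mem_closedBall_iff_norm.2 ((hρ z hz).trans (le_max_left _ _))
  have h1 : Fa.toFun 1 z = g x₀ + L₁ (z - c) := by
    have := hFa z hzc
    simpa using this
  rw [AmbientIsotopy.comp_toFun, comp_apply, h1, AmbientIsotopy.conjDiffeo_toFun, comp_apply,
    comp_apply, affineDiffeo_symm_apply, affineDiffeo_apply]
  have h2 : L.symm (g x₀ + L₁ (z - c) - a) = x₀ + l • M (z - c) := by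
    rw [ha, hL₁, smulEquiv_apply]
    apply L.injective
    simp only [map_add, map_sub, map_smul, ContinuousLinearEquiv.apply_symm_apply,
      ContinuousLinearEquiv.trans_apply]
    abel
  rw [h2]
  have h3 := (hball (hT z hz)).1
  simp only [mem_setOf_eq] at h3
  rw [h3, ha]
  simp only [map_sub]
  abel

end Composite

end Literature.Topology.FourManifolds
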